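import Summits.FinalStateConjecture.FinalStateConjecture.Theorems.BartnikGapSettlingSettledCaptureCrushDefs
import Summits.FinalStateConjecture.FinalStateConjecture.Theorems.BartnikGapSettlingSettledCaptureCrushShellConstants
import Literature.Geometry.Lorentzian.CoordLaplacianChainRule
import Literature.Geometry.Lorentzian.CoordScalarCurvatureEvolution
import Mathlib.Analysis.SpecialFunctions.ExpDeriv
import HarnessLib

/-!
# Crux `SettledCapture` (stmt-FinalStateConjecture-17328), line `null-concave-crush`:
# stub 2 `stub_kerrCrushCertificate` — the exact-Kerr weighted null-concave crush certificate

Route `BartnikGapSettling`; helper (`--supports stmt-FinalStateConjecture-17328`) landing the registered stub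
`stub_kerrCrushCertificate` of the checked skeleton `Cruxes/SettledCapture/Lines/null_concave_crush.lean`:
**for every sub-extremal Kerr `(M, a)` and every depth `δ > 0` there are a `C²` radial profile `F`, a weight
`ρ < 1` and a margin `m > 0` such that `KerrCrushCertificate M a (r₋ + δ) (r₊ − δ) ρ m F` holds** — on the
ingoing-Kerr–Schild shell `{r₋ + δ ≤ r ≤ r₊ − δ}` of block II, `f = F ∘ r` has `df(w) ≤ −m‖w‖` on future null `w`
and `f · Hess f(w,w) − ρ df(w)² ≤ −m‖w‖²` on all null `w`.

## The proof (no Carter separation, no case split in the spin)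

Two SOFT shell constants and one closed-form profile:

* `c > 0` with `c‖w‖ ≤ |dr(w)|` for every `g_{M,a}`-null `w` at every shell point (quantitative form of
  "`∇r` is timelike on block II": pointwise `dr(w) ≠ 0` for null `w ≠ 0` by `Kerr.radiusGrad_lt_zero_of_isFutureDirected`
  applied to `±w`; uniformity by compactness of the normalised constraint set over the time slice `{z⁰ = 0}` of the shell and
  stationarity — `stub_crushSlopeConstant` of `BartnikGapSettlingSettledCaptureCrushShellConstants.lean`), and `dr(w) < 0`
  for future-directed null `w` (`crush_fderiv_radius_neg_of_future`);
* `C ≥ 0` with `|Hess r(w,w)| ≤ C‖w‖²` at every shell point (`crush_hess_constant`, same file);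
* with `K := max (C/c²) 1` (so `Hess r(w,w) ≤ K dr(w)²` on null `w`), `κ := 2K`, the profile
  `F(r) := exp(−½ e^{κ(r₁ − r)})`, `r₁ = r₋ + δ`, weight `ρ := ½`: writing `φ'(r) = K e^{κ(r₁−r)} ∈ (0, K]`,
  `F' = F φ'`, `F'' = F(φ'² − κφ')`, the chain rule `Hess(F∘r) = F' Hess r + F'' dr ⊗ dr` gives
  `F · Hess(F∘r)(w,w) − ½ (d(F∘r) w)² ≤ F² φ' (½φ' − K) dr(w)² ≤ −(K/2) F² φ' dr(w)² ≤ −m‖w‖²`.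

References: O'Neill 1995 §2.5 (`r` is a time function on block II); O'Neill 1983 Ch. 3 Lemma 3.49 (Hessian chain
rule); crux idea card `Cruxes/SettledCapture/Ideas/null-concave-crush.md` (the certificate shape; kit j023930).
-/

noncomputable section

-- instance search through the nested operator types `E4 →L[ℝ] E4 →L[ℝ] E4 →L[ℝ] ℝ`
set_option maxSynthPendingDepth 3

-- D-0017: single-problem summit, `Summit.<S>.<S>.…` by design (cf. lakefile `weak.linter.dupNamespace`).
set_option linter.dupNamespace false

namespace Summit.FinalStateConjecture.FinalStateConjecture.Theorems.BartnikGapSettling.SettledCapture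

open Set Filter Function TopologicalSpace
open scoped Topology
open Literature.Geometry.Lorentzian Literature.Geometry.Lorentzian.MetricCoord
open Summit.FinalStateConjecture.FinalStateConjecture.Theorems

/-! ### The profile `F(r) = exp(−½ e^{κ(r₁ − r)})` -/

/-- The exponent `φ(r) = −½ e^{κ(r₁ − r)}` of the profile. -/
private def crushPhi (κ r₁ r : ℝ) : ℝ := -(1 / 2) * Real.exp (κ * (r₁ - r))

/-- The crush profile `F(r) = exp(φ(r)) = exp(−½ e^{κ(r₁ − r)})`. -/
private def crushF (κ r₁ r : ℝ) : ℝ := Real.exp (crushPhi κ r₁ r)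

/-- `φ' = (κ/2) e^{κ(r₁ − r)}`. -/
private theorem hasDerivAt_crushPhi (κ r₁ r : ℝ) :
    HasDerivAt (crushPhi κ r₁) ((κ / 2) * Real.exp (κ * (r₁ - r))) r := by
  have h1 : HasDerivAt (fun r ↦ κ * (r₁ - r)) (-κ) r := by
    simpa using ((hasDerivAt_id r).const_sub r₁).const_mul κ
  have h2 := ((Real.hasDerivAt_exp _).comp r h1).const_mul (-(1 / 2))
  have h3 : HasDerivAt (crushPhi κ r₁) (-(1 / 2) * (Real.exp (κ * (r₁ - r)) * -κ)) r := h2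
  convert h3 using 1
  ring

/-- `φ'` as a `deriv`. -/
private theorem deriv_crushPhi (κ r₁ : ℝ) :
    deriv (crushPhi κ r₁) = fun r ↦ (κ / 2) * Real.exp (κ * (r₁ - r)) :=
  funext fun r ↦ (hasDerivAt_crushPhi κ r₁ r).deriv

/-- `F' = F φ'`. -/
private theorem hasDerivAt_crushF (κ r₁ r : ℝ) :
    HasDerivAt (crushF κ r₁) (crushF κ r₁ r * ((κ / 2) * Real.exp (κ * (r₁ - r)))) r :=
  (Real.hasDerivAt_exp _).comp r (hasDerivAt_crushPhi κ r₁ r)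

/-- `F'` as a `deriv`. -/
private theorem deriv_crushF (κ r₁ : ℝ) :
    deriv (crushF κ r₁) = fun r ↦ crushF κ r₁ r * ((κ / 2) * Real.exp (κ * (r₁ - r))) :=
  funext fun r ↦ (hasDerivAt_crushF κ r₁ r).deriv

/-- `F'' = F(φ'² − κφ')`. -/
private theorem deriv_deriv_crushF (κ r₁ r : ℝ) :
    deriv (deriv (crushF κ r₁)) r =
      crushF κ r₁ r * ((κ / 2) * Real.exp (κ * (r₁ - r))) ^ 2 -
        crushF κ r₁ r * (κ * ((κ / 2) * Real.exp (κ * (r₁ - r)))) := by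
  rw [deriv_crushF]
  have h1 : HasDerivAt (fun r ↦ κ * (r₁ - r)) (-κ) r := by
    simpa using ((hasDerivAt_id r).const_sub r₁).const_mul κ
  have h2 : HasDerivAt (fun r ↦ (κ / 2) * Real.exp (κ * (r₁ - r)))
      ((κ / 2) * (Real.exp (κ * (r₁ - r)) * -κ)) r :=
    ((Real.hasDerivAt_exp _).comp r h1).const_mul (κ / 2)
  have h3 : HasDerivAt (fun y ↦ crushF κ r₁ y * ((κ / 2) * Real.exp (κ * (r₁ - y))))
      (crushF κ r₁ r * ((κ / 2) * Real.exp (κ * (r₁ - r))) * ((κ / 2) * Real.exp (κ * (r₁ - r))) +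
        crushF κ r₁ r * ((κ / 2) * (Real.exp (κ * (r₁ - r)) * -κ))) r :=
    (hasDerivAt_crushF κ r₁ r).mul h2
  rw [h3.deriv]
  ring

/-- `F` is `C²` (indeed smooth). -/
private theorem contDiff_crushF (κ r₁ : ℝ) : ContDiff ℝ 2 (crushF κ r₁) := by
  unfold crushF crushPhi
  fun_prop

/-- `F > 0`. -/
private theorem crushF_pos (κ r₁ r : ℝ) : 0 < crushF κ r₁ r := Real.exp_pos _

/-- On `r₁ ≤ r` the profile is at least `e^{−1/2}` (for `κ ≥ 0`). -/
private theorem exp_neg_half_le_crushF {κ r₁ r : ℝ} (hκ : 0 ≤ κ) (hr : r₁ ≤ r) :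
    Real.exp (-(1 / 2)) ≤ crushF κ r₁ r := by
  unfold crushF crushPhi
  apply Real.exp_le_exp.2
  have h1 : Real.exp (κ * (r₁ - r)) ≤ 1 := by
    rw [Real.exp_le_one_iff]
    nlinarith
  nlinarith [Real.exp_pos (κ * (r₁ - r))]

/-! ### The stub -/

/-- **Stub 2 of line `null-concave-crush` (crux `SettledCapture`, stmt-FinalStateConjecture-17328): the exact-Kerr
weighted null-concave crush certificate, for ALL sub-extremal `(M, a)`.** For `0 < M`, `|a| < M`, `δ > 0` there are
`F`, `ρ < 1`, `m > 0` with `KerrCrushCertificate M a (r₋ + δ) (r₊ − δ) ρ m F`: `F(r) = exp(−½ e^{2K(r₋+δ−r)})`,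
`ρ = ½`, with `K = max (C/c²) 1` built from the two soft shell constants `c‖w‖ ≤ |dr(w)|` (null `w`;
`stub_crushSlopeConstant`) and `|Hess r(w,w)| ≤ C‖w‖²` (`crush_hess_constant`). [folklore] -/
theorem stub_kerrCrushCertificate : ∀ (M a δ : ℝ), 0 < M → |a| < M → 0 < δ → ∃ (F : ℝ → ℝ) (ρ m : ℝ), ρ < 1 ∧ 0 < m ∧ KerrCrushCertificate M a (Kerr.rMinus M a + δ) (Kerr.rPlus M a - δ) ρ m F := by
  intro M a δ hM ha hδ
  set r₁ : ℝ := Kerr.rMinus M a + δ with hr₁def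
  set r₂ : ℝ := Kerr.rPlus M a - δ with hr₂def
  have hr₁pos : 0 < r₁ := by
    have := Kerr.IsSubextremal.rMinus_nonneg ha
    rw [hr₁def]; linarith
  have h₁ : Kerr.rMinus M a < r₁ := by rw [hr₁def]; linarith
  have h₂ : r₂ < Kerr.rPlus M a := by rw [hr₂def]; linarith
  -- the two shell constants
  obtain ⟨c, hc, hcw⟩ := stub_crushSlopeConstant M a r₁ r₂ hM ha h₁ h₂
  obtain ⟨C, hC0, hCw⟩ := crush_hess_constant M a (r₁ := r₁) r₂ hr₁pos
  -- the constants of the profile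
  set K : ℝ := max (C / c ^ 2) 1 with hKdef
  have hK1 : 1 ≤ K := le_max_right _ _
  have hK0 : 0 < K := one_pos.trans_le hK1
  have hKC : C / c ^ 2 ≤ K := le_max_left _ _
  set κ : ℝ := 2 * K with hκdef
  have hκ0 : 0 ≤ κ := by rw [hκdef]; linarith
  -- `φ'(r) = K e^{κ(r₁ − r)}`, its range on the shell
  have hφ'le : ∀ r, r₁ ≤ r → (κ / 2) * Real.exp (κ * (r₁ - r)) ≤ K := by
    intro r hr
    have h1 : Real.exp (κ * (r₁ - r)) ≤ 1 := by
      rw [Real.exp_le_one_iff]; nlinarith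
    have : κ / 2 = K := by rw [hκdef]; ring
    rw [this]
    nlinarith
  set φmin : ℝ := K * Real.exp (κ * (r₁ - r₂)) with hφmin
  have hφmin0 : 0 < φmin := mul_pos hK0 (Real.exp_pos _)
  have hφ'ge : ∀ r, r ≤ r₂ → φmin ≤ (κ / 2) * Real.exp (κ * (r₁ - r)) := by
    intro r hr
    have : κ / 2 = K := by rw [hκdef]; ring
    rw [this, hφmin]
    refine mul_le_mul_of_nonneg_left (Real.exp_le_exp.2 ?_) hK0.le
    nlinarith
  -- the margins
  set m₁ : ℝ := Real.exp (-(1 / 2)) * φmin * c with hm₁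
  set m₂ : ℝ := Real.exp (-(1 / 2)) ^ 2 * φmin * (K / 2) * c ^ 2 with hm₂
  have hm₁0 : 0 < m₁ := by rw [hm₁]; positivity
  have hm₂0 : 0 < m₂ := by rw [hm₂]; positivity
  refine ⟨crushF κ r₁, 1 / 2, min m₁ m₂, by norm_num, lt_min hm₁0 hm₂0, contDiff_crushF κ r₁,
    fun r _ ↦ crushF_pos κ r₁ r, ?_⟩
  intro x hx₁ hx₂ w hnull
  have hx : 0 < Kerr.radius a x := hr₁pos.trans_le hx₁
  have hxII₁ : Kerr.rMinus M a < Kerr.radius a x := h₁.trans_le hx₁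
  have hxII₂ : Kerr.radius a x < Kerr.rPlus M a := lt_of_le_of_lt hx₂ h₂
  -- names: `r = r(x)`, `u = dr_x(w)`, `H = Hess r_x(w,w)`, `Fv = F(r)`, `φ' = φ'(r)`
  set r : ℝ := Kerr.radius a x with hrdef
  set u : ℝ := fderiv ℝ (Kerr.radius a) x w with hudef
  set H : ℝ := hessAt (Kerr.bilin M a) (Kerr.radius a) x w w with hHdef
  set Fv : ℝ := crushF κ r₁ r with hFvdef
  set φ' : ℝ := (κ / 2) * Real.exp (κ * (r₁ - r)) with hφ'def
  have hFv0 : 0 < Fv := crushF_pos κ r₁ r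
  have hFvge : Real.exp (-(1 / 2)) ≤ Fv := exp_neg_half_le_crushF hκ0 hx₁
  have hφ'K : φ' ≤ K := hφ'le r hx₁
  have hφ'm : φmin ≤ φ' := hφ'ge r hx₂
  have hφ'0 : 0 < φ' := hφmin0.trans_le hφ'm
  -- differentiability of `r` at `x` (needed by the chain rules)
  have hrC : ContDiffAt ℝ 2 (Kerr.radius a) x :=
    ((Kerr.contDiffOn_radius_region a 0).contDiffAt
      ((Kerr.region a 0).isOpen.mem_nhds
        (show x ∈ Kerr.region a 0 by rw [Kerr.mem_region, max_self]; exact hx))).of_le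
      (WithTop.coe_le_coe.2 le_top)
  -- chain rules: `d(F∘r)(w) = F'(r) u`, `Hess(F∘r)(w,w) = F'(r) H + F''(r) u²`
  have hderF : deriv (crushF κ r₁) r = Fv * φ' := by rw [deriv_crushF]
  have hder2F : deriv (deriv (crushF κ r₁)) r = Fv * φ' ^ 2 - Fv * (κ * φ') :=
    deriv_deriv_crushF κ r₁ r
  have hfd : fderiv ℝ (crushF κ r₁ ∘ Kerr.radius a) x w = Fv * φ' * u := by
    have h := (hasDerivAt_crushF κ r₁ r).comp_hasFDerivAt x
      ((hrC.differentiableAt (by norm_num)).hasFDerivAt)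
    rw [h.fderiv, _root_.smul_apply, smul_eq_mul]
  have hhess : hessAt (Kerr.bilin M a) (crushF κ r₁ ∘ Kerr.radius a) x w w =
      Fv * φ' * H + (Fv * φ' ^ 2 - Fv * (κ * φ')) * u ^ 2 := by
    rw [show crushF κ r₁ ∘ Kerr.radius a = fun y ↦ crushF κ r₁ (Kerr.radius a y) from rfl,
      hessAt_comp (contDiff_crushF κ r₁) hrC]
    simp only [_root_.add_apply, _root_.smul_apply, smul_eq_mul, ContinuousLinearMap.smulRight_apply]
    rw [← hrdef, ← hudef, ← hHdef, hderF, hder2F]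
    ring
  -- the two soft bounds at `(x, w)`
  have hcu : c * ‖w‖ ≤ |u| := hcw x w hx₁ hx₂ hnull
  have hCH : |H| ≤ C * ‖w‖ ^ 2 := hCw x w hx₁ hx₂
  have hu2 : c ^ 2 * ‖w‖ ^ 2 ≤ u ^ 2 := by
    have h0 : 0 ≤ c * ‖w‖ := by positivity
    calc c ^ 2 * ‖w‖ ^ 2 = (c * ‖w‖) ^ 2 := by ring
      _ ≤ |u| ^ 2 := pow_le_pow_left₀ h0 hcu 2
      _ = u ^ 2 := sq_abs u
  have hHK : H ≤ K * u ^ 2 := by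
    have hw2 : ‖w‖ ^ 2 ≤ u ^ 2 / c ^ 2 := by
      rw [le_div_iff₀ (by positivity)]; linarith
    calc H ≤ |H| := le_abs_self H
      _ ≤ C * ‖w‖ ^ 2 := hCH
      _ ≤ C * (u ^ 2 / c ^ 2) := mul_le_mul_of_nonneg_left hw2 hC0
      _ = C / c ^ 2 * u ^ 2 := by ring
      _ ≤ K * u ^ 2 := mul_le_mul_of_nonneg_right hKC (sq_nonneg u)
  refine ⟨fun hfut ↦ ?_, ?_⟩
  · -- slope: `d(F∘r)(w) = F φ' u ≤ −m₁‖w‖ ≤ −m‖w‖`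
    have hfut' : Kerr.bilin M a x (Kerr.timeVector M a x) w < 0 := by rwa [Kerr.bilin_symm] at hfut
    have hu0 : u < 0 := crush_fderiv_radius_neg_of_future ha hxII₁ hxII₂ hnull hfut'
    have hule : u ≤ -(c * ‖w‖) := by
      have : |u| = -u := abs_of_neg hu0
      linarith
    rw [hfd]
    have hFφ : Real.exp (-(1 / 2)) * φmin ≤ Fv * φ' :=
      mul_le_mul hFvge hφ'm hφmin0.le hFv0.le
    have hP : 0 < Fv * φ' := mul_pos hFv0 hφ'0
    calc Fv * φ' * u ≤ Fv * φ' * (-(c * ‖w‖)) := mul_le_mul_of_nonneg_left hule hP.le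
      _ = -((Fv * φ') * (c * ‖w‖)) := by ring
      _ ≤ -((Real.exp (-(1 / 2)) * φmin) * (c * ‖w‖)) := by
          have h0 : 0 ≤ c * ‖w‖ := by positivity
          have := mul_le_mul_of_nonneg_right hFφ h0
          linarith
      _ = -(m₁ * ‖w‖) := by rw [hm₁]; ring
      _ ≤ -(min m₁ m₂ * ‖w‖) := by
          have := mul_le_mul_of_nonneg_right (min_le_left m₁ m₂) (norm_nonneg w)
          linarith
  · -- weighted concavity: `F·Hess(F∘r)(w,w) − ½ (d(F∘r) w)² ≤ F²φ'(½φ' − K) u² ≤ −(K/2)F²φ' u²`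
    rw [hhess, hfd]
    have hstep : Fv * (Fv * φ' * H + (Fv * φ' ^ 2 - Fv * (κ * φ')) * u ^ 2) -
        1 / 2 * (Fv * φ' * u) ^ 2 ≤ -(K / 2) * (Fv ^ 2 * φ' * u ^ 2) := by
      have hid : Fv * (Fv * φ' * H + (Fv * φ' ^ 2 - Fv * (κ * φ')) * u ^ 2) -
          1 / 2 * (Fv * φ' * u) ^ 2 =
          Fv ^ 2 * φ' * H + Fv ^ 2 * φ' * u ^ 2 * (1 / 2 * φ' - 2 * K) := by
        rw [hκdef]; ring
      rw [hid]
      have hP2 : 0 ≤ Fv ^ 2 * φ' := by positivity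
      have hA : Fv ^ 2 * φ' * H ≤ Fv ^ 2 * φ' * (K * u ^ 2) := mul_le_mul_of_nonneg_left hHK hP2
      have hB : Fv ^ 2 * φ' * u ^ 2 * (1 / 2 * φ' - 2 * K + K) ≤ Fv ^ 2 * φ' * u ^ 2 * (-(K / 2)) :=
        mul_le_mul_of_nonneg_left (by linarith) (by positivity)
      linarith
    have hmain : -(K / 2) * (Fv ^ 2 * φ' * u ^ 2) ≤ -(m₂ * ‖w‖ ^ 2) := by
      have hF2 : Real.exp (-(1 / 2)) ^ 2 ≤ Fv ^ 2 :=
        pow_le_pow_left₀ (Real.exp_pos _).le hFvge 2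
      have h1 : Real.exp (-(1 / 2)) ^ 2 * φmin * (c ^ 2 * ‖w‖ ^ 2) ≤ Fv ^ 2 * φ' * u ^ 2 :=
        mul_le_mul (mul_le_mul hF2 hφ'm hφmin0.le (sq_nonneg Fv)) hu2 (by positivity)
          (by positivity)
      have h2 := mul_le_mul_of_nonneg_left h1 (show 0 ≤ K / 2 by positivity)
      have h3 : K / 2 * (Real.exp (-(1 / 2)) ^ 2 * φmin * (c ^ 2 * ‖w‖ ^ 2)) = m₂ * ‖w‖ ^ 2 := by
        rw [hm₂]; ring
      linarith
    have hmle : min m₁ m₂ * ‖w‖ ^ 2 ≤ m₂ * ‖w‖ ^ 2 :=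
      mul_le_mul_of_nonneg_right (min_le_right _ _) (sq_nonneg _)
    linarith

end Summit.FinalStateConjecture.FinalStateConjecture.Theorems.BartnikGapSettling.SettledCapture

end
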